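import Literature.Computability.Cryptography.ShorDiscreteLogPostFP
import Literature.Computability.Cryptography.ShorDiscreteLogUniform
import Literature.Computability.QuantumComplexity.CWrapAssembly
import HarnessLib

/-!
# Shor's discrete-logarithm theorem (`isQSolvable_dlog` discharged)

Family `PQC` (trunk `CryptoQuantFine`); closes the chain of companions of
`Literature/Computability/Cryptography/Shor.lean` for the named fact `isQSolvable_dlog`
(**pqc.S06**, Shor 1997, §6: "Suppose we are given a prime `p` and such a generator `g`. The
discrete logarithm of a number `x` with respect to `p` and `g` is the integer `r` with
`0 ≤ r < p − 1` such that `g^r ≡ x (mod p)`. … We show how to find discrete logarithms on a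
quantum computer with two modular exponentiations and two quantum Fourier transforms"). Over
the tree's model (poly-time uniform oracle-free Clifford+T families measured on all wires,
`IsQSolvable`) the exact route is Kitaev's (1995): the discrete logarithm as the Abelian
stabilizer problem with two generators, solved by eigenvalue measurements of "multiply by `g`"
and "multiply by `y`" on shared registers (`ShorDiscreteLogQuantum.lean`, whose assembly theorem
`isQSolvable_dlog_of` takes three named infrastructure facts). All three are now theorems:

* `isQSolvable_classicalWrap_holds` — classical pre- and post-processing inside bounded-error
  quantum search (`QuantumComplexity/CWrapAssembly.lean`, on `CWrapLayout` … `CWrapUniform`;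
  Bernstein–Vazirani 1997, §8);
* `Kitaev1995_dlogFamily_holds` — the uniform Kitaev family around the clean double
  modular-exponentiation block (`ShorDiscreteLogBlock.lean`, `ShorDiscreteLogUniform.lean`;
  Shor 1997, §3 and §6 p. 16; Kitaev 1995, §2.2 Lemma 1, §4 p. 15);
* `dlogPost_mem_FP_holds` — the classical post-processor is polynomial time
  (`ShorDiscreteLogPostFP.lean`; Kitaev 1995, §3 Lemma 10).

## References

* P. W. Shor, *Polynomial-time algorithms for prime factorization and discrete logarithms on a
  quantum computer*, SIAM J. Comput. 26 (1997) 1484–1509 (= arXiv:quant-ph/9508027v2), §6.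
* A. Yu. Kitaev, *Quantum measurements and the Abelian Stabilizer Problem*,
  arXiv:quant-ph/9511026 (1995), §1 p. 5, §2.2, §3, §4.
* E. Bernstein, U. Vazirani, *Quantum complexity theory*, SIAM J. Comput. 26 (1997), §8.
-/

noncomputable section

namespace Literature.Computability.Cryptography

/-- **Shor's theorem, discrete logarithms** (**pqc.S06**; Shor 1997, §6): the discrete logarithm
problem — given a prime `p`, a primitive root `g` modulo `p` and a unit `y`, find the `a < p - 1`
with `g ^ a ≡ y (mod p)` — is solvable in bounded-error quantum polynomial time, in the tree's
FBQP form `isQSolvable_dlog` (`Shor.lean`). Unconditional: `isQSolvable_dlog_of`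
(`ShorDiscreteLogQuantum.lean`) fed with the three discharged infrastructure facts.
[cite: Shor1997, §6 (discrete logarithms in quantum polynomial time)] -/
theorem isQSolvable_dlog_holds : isQSolvable_dlog :=
  isQSolvable_dlog_of isQSolvable_classicalWrap_holds Kitaev1995_dlogFamily_holds dlogPost_mem_FP_holds

end Literature.Computability.Cryptography

end
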